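import Literature.Probability.RandomPlanarGeometry.SLESameSideEnergy
import HarnessLib

/-!
# The same-side two-point problem: pathwise facts for the sharp law

Trunk T-STOCH; deterministic (path-by-path) layer of the **sharp** same-side two-point law of the
real SLE_κ flow, `4 < κ < 8`, `0 < y < x` (S. Rohde, O. Schramm, *Basic properties of SLE*, Ann.
of Math. 161 (2005), Lemma 6.6, proof p. 908). With the levels along the diagonal
`δ₁ = y/(n+2)`, `R₁ = y + n + 1`, `δ₀ = δ₁/(2(x-y))` (so that the lower `Z`-level never fires before
the lower `Y`-level, `div_le_sameSideRatio_sub_one`) and a fixed upper level `1 + R > z₀`: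

* `sameSideKernel_sq_div_sq_ge` — the algebra `K(Z)²/(X-Y)² ≥ ((1+R)R)^{1-4a}/(XY)` for
  `Z = X/(X-Y) < 1 + R` (`K(Z)² = (Z(Z-1))^{-4a}`, `Z(Z-1) = XY/(X-Y)²`, and `1 - 4a < 0`: this is
  where `κ < 8` enters);
* `exists_le_integral_sameSide_energy` — **on `{T_y = T_x = T < ∞, Z < 1 + R on [0, T)}` the energy
  `∫₀ᵗ κ K(Z_s)²/(X_s-Y_s)² ds` is unbounded as `t ↑ T`**: it dominates
  `c ∫₀ᵗ 2/(X_s Y_s) ds = c (log(x-y) - log(X_t - Y_t))` (`log_sleRealFlowStop_gap_eq`), and the gap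
  `X_t - Y_t < X_t → 0` at `T = T_x`;
* `exists_forall_lt_exitTime` — before `T_y` the diagonal `Y`-levels are eventually not reached on
  `[0, t]`;
* `eventually_sameSide_stopped_ratio_eq` — **if `Z_t ≥ 1 + R` at some `t < T_y`, then for all large
  `n` the ratio stopped at the diagonal stopping time `ρ_n`, read at time `n`, equals `1 + R`**;
* `eventually_le_sameSide_energy` — **on the above bad event, the stopped energies
  `∫₀^{n∧ρ_n}` eventually exceed any constant**.

The measure-theoretic conclusion (`P[bad] = 0` by the uniform energy bound
`integral_sameSide_energy_le` and Fatou; `P[Z reaches 1+R] ≤ (h(z₀)-h(1))/(h(1+R)-h(1))` by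
`measureReal_sameSide_hit_le`) is drawn in the sequel.

## References

* S. Rohde, O. Schramm, *Basic properties of SLE*, Ann. of Math. 161 (2005), Lemma 6.6 (proof).
* G. F. Lawler, *Conformally Invariant Processes in the Plane*, AMS (2005), §6.7, Prop. 6.34.
-/

noncomputable section

open MeasureTheory ProbabilityTheory Filter Set Topology
open scoped NNReal ENNReal

namespace Literature.Probability.RandomPlanarGeometry

open Loewner Literature.Probability.Process Literature.Analysis.FunctionSpaces
  Literature.Analysis.Calculus

variable {κ : ℝ≥0} {x y : ℝ}

/-! ### The algebra of the energy rate -/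

/-- **The energy rate dominates `2/(XY)`**: for `1/4 ≤ a`, `0 < R`, `0 < Y < X` and
`Z = X/(X-Y) < 1 + R`: `((1+R)R)^{1-4a}/(XY) ≤ K_a(Z)²/(X-Y)²` (`K_a(Z)² = (Z(Z-1))^{-4a}`,
`Z(Z-1)(X-Y)² = XY`, `Z(Z-1) ≤ (1+R)R` and `1 - 4a ≤ 0`). [folklore] -/
theorem sameSideKernel_sq_div_sq_ge {a R X Y : ℝ} (ha : 1 / 4 ≤ a) (hR : 0 < R) (hY : 0 < Y)
    (hYX : Y < X) (hZ : X / (X - Y) < 1 + R) :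
    ((1 + R) * R) ^ (1 - 4 * a) / (X * Y) ≤ sameSideKernel a (X / (X - Y)) ^ 2 / (X - Y) ^ 2 := by
  have hU : 0 < X - Y := sub_pos.2 hYX
  have hX : 0 < X := hY.trans hYX
  set Z := X / (X - Y) with hZdef
  have hZ1 : Z - 1 = Y / (X - Y) := by rw [hZdef]; field_simp; ring
  have hZpos : 0 < Z := div_pos hX hU
  have hZ1pos : 0 < Z - 1 := by rw [hZ1]; exact div_pos hY hU
  set w := Z * (Z - 1) with hw
  have hwpos : 0 < w := mul_pos hZpos hZ1pos
  have hwXY : w * (X - Y) ^ 2 = X * Y := by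
    rw [hw, hZ1, hZdef]
    field_simp
  have hwW : w ≤ (1 + R) * R := by
    have h1 : Z ≤ 1 + R := hZ.le
    have h2 : Z - 1 ≤ R := by linarith
    exact mul_le_mul h1 h2 hZ1pos.le (by linarith)
  -- `K(Z)² = w^{-4a}` (`(r^p)² = r^{2p}` for `r ≥ 0`)
  have hsq : ∀ {r : ℝ}, 0 ≤ r → ∀ p : ℝ, (r ^ p) ^ 2 = r ^ (2 * p) := fun hr p ↦ by
    rw [← Real.rpow_natCast, ← Real.rpow_mul hr]
    congr 1
    push_cast
    ring
  have hK : sameSideKernel a Z ^ 2 = w ^ (-(4 * a)) := by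
    rw [sameSideKernel, mul_pow, hsq hZpos.le, hsq hZ1pos.le, hw,
      Real.mul_rpow hZpos.le hZ1pos.le]
    congr 1 <;> (congr 1; ring)
  -- `w^{-4a} = w⁻¹ w^{1-4a} ≥ w⁻¹ W^{1-4a}`
  have hsplit : w ^ (-(4 * a)) = w⁻¹ * w ^ (1 - 4 * a) := by
    rw [← Real.rpow_neg_one, ← Real.rpow_add hwpos]
    congr 1; ring
  have hmono : ((1 + R) * R) ^ (1 - 4 * a) ≤ w ^ (1 - 4 * a) :=
    Real.rpow_le_rpow_of_nonpos hwpos hwW (by linarith)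
  have hWpos : 0 < (1 + R) * R := by positivity
  calc ((1 + R) * R) ^ (1 - 4 * a) / (X * Y)
        = ((1 + R) * R) ^ (1 - 4 * a) * (w⁻¹ / (X - Y) ^ 2) := by
          rw [← hwXY]; field_simp
    _ ≤ w ^ (1 - 4 * a) * (w⁻¹ / (X - Y) ^ 2) := mul_le_mul_of_nonneg_right hmono (by positivity)
    _ = sameSideKernel a Z ^ 2 / (X - Y) ^ 2 := by rw [hK, hsplit]; ring

/-! ### The energy is unbounded on the bad event -/

/-- **On `{T_y = T_x = T < ∞}` with `Z < 1 + R` throughout `[0, T)`, the energy is unbounded**: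
for `4 < κ < 8`, `0 < y < x` and every `C`, some `t < T` has
`C ≤ ∫₀ᵗ κ K(Z_s)²/(X_s - Y_s)² ds` (`K = sameSideKernel (2/κ)`, `Z = X/(X-Y)`). The integrand is
at least `c · 2/(X_s Y_s)`, `c = κ ((1+R)R)^{1-8/κ}/2` (`sameSideKernel_sq_div_sq_ge`), and
`∫₀ᵗ 2/(XY) = log(x-y) - log(X_t - Y_t)` (`log_sleRealFlowStop_gap_eq`) with
`X_t - Y_t < X_t → X_T = 0`. [cite: RohdeSchramm2005, proof of Lemma 6.6] -/
theorem exists_le_integral_sameSide_energy (hκ4 : 4 < κ) (hκ8 : κ < 8) (hy : 0 < y) (hyx : y < x)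
    {R : ℝ} (hR : 0 < R) {ω : ℝ≥0 → ℝ} {T : ℝ≥0}
    (hTy : swallowingTime (sleDriving κ ω) y = T) (hTx : swallowingTime (sleDriving κ ω) x = T)
    (hZ : ∀ t : ℝ≥0, t < T →
      sleRealFlowStop κ x t ω / (sleRealFlowStop κ x t ω - sleRealFlowStop κ y t ω) < 1 + R)
    (C : ℝ) :
    ∃ t : ℝ≥0, t < T ∧ C ≤ ∫ s in (0 : ℝ)..t,
      (κ : ℝ) * sameSideKernel (2 / (κ : ℝ))
          (sleRealFlowStop κ x s.toNNReal ω /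
            (sleRealFlowStop κ x s.toNNReal ω - sleRealFlowStop κ y s.toNNReal ω)) ^ 2 /
        (sleRealFlowStop κ x s.toNNReal ω - sleRealFlowStop κ y s.toNNReal ω) ^ 2 := by
  have hx : 0 < x := hy.trans hyx
  have hxy : 0 < x - y := by linarith
  have hκ0 : (0 : ℝ) < κ := by exact_mod_cast lt_trans (by norm_num) hκ4
  have hκ4' : (4 : ℝ) < κ := by exact_mod_cast hκ4
  have hκ8' : (κ : ℝ) < 8 := by exact_mod_cast hκ8
  set a : ℝ := 2 / (κ : ℝ) with ha
  have ha4 : 1 / 4 ≤ a := by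
    rw [ha, div_le_div_iff₀ (by norm_num) hκ0]; linarith
  set W : ℝ := (1 + R) * R with hW
  have hWpos : 0 < W := by positivity
  set c : ℝ := (κ : ℝ) * W ^ (1 - 4 * a) / 2 with hc
  have hcpos : 0 < c := by positivity
  -- real-variable versions of the flows
  set X : ℝ → ℝ := fun r ↦ sleRealFlowStop κ x r.toNNReal ω with hX
  set Y : ℝ → ℝ := fun r ↦ sleRealFlowStop κ y r.toNNReal ω with hY
  have hXc : Continuous X := (continuous_sleRealFlowStop hx.ne' ω).comp continuous_real_toNNReal
  have hYc : Continuous Y := (continuous_sleRealFlowStop hy.ne' ω).comp continuous_real_toNNReal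
  -- `T > 0`
  have hT0 : 0 < T := by
    have h := swallowingTime_pos_holds (continuous_sleDriving κ ω) (z := (y : ℂ))
      (by rw [sleDriving_zero]; exact_mod_cast hy.ne')
    rw [hTy] at h
    exact_mod_cast h
  -- facts at times `t < T`
  have hfacts : ∀ t : ℝ≥0, t < T → 0 < sleRealFlowStop κ y t ω ∧
      sleRealFlowStop κ y t ω < sleRealFlowStop κ x t ω := by
    intro t ht
    have ht' : (t : WithTop ℝ≥0) < swallowingTime (sleDriving κ ω) y := by
      rw [hTy]; exact_mod_cast ht
    have h := sleRealFlowStop_sameSide_facts (κ := κ) hy hyx ht'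
    exact ⟨h.1, h.2.1⟩
  -- choose `t < T` with `X_t < ε`, `ε = exp(log(x-y) - (C+1)/c)`
  set ε : ℝ := Real.exp (Real.log (x - y) - (C + 1) / c) with hε
  have hεpos : 0 < ε := Real.exp_pos _
  have hXT : sleRealFlowStop κ x T ω = 0 := by
    rw [sleRealFlowStop_apply, realFlowStop_of_le (by rw [hTx])]
  obtain ⟨t, htT, hXt⟩ : ∃ t : ℝ≥0, t < T ∧ sleRealFlowStop κ x t ω < ε := by
    haveI : (𝓝[<] T).NeBot := nhdsLT_neBot_of_exists_lt ⟨0, hT0⟩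
    have hev : ∀ᶠ s in 𝓝 T, sleRealFlowStop κ x s ω < ε := by
      have hc' := (continuous_sleRealFlowStop (κ := κ) hx.ne' ω).continuousAt (x := T)
      rw [ContinuousAt, hXT] at hc'
      exact hc' (Iio_mem_nhds hεpos)
    have h2 : ∀ᶠ s in 𝓝[<] T, sleRealFlowStop κ x s ω < ε ∧ s ∈ Iio T :=
      (hev.filter_mono nhdsWithin_le_nhds).and eventually_mem_nhdsWithin
    obtain ⟨s, hs, hsT⟩ := h2.exists
    exact ⟨s, hsT, hs⟩
  refine ⟨t, htT, ?_⟩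
  have htT' : (t : WithTop ℝ≥0) < swallowingTime (sleDriving κ ω) y := by
    rw [hTy]; exact_mod_cast htT
  -- facts along `[0, t]` for the real-variable flows
  have hfactsr : ∀ r ∈ Icc (0 : ℝ) t, 0 < Y r ∧ Y r < X r ∧ X r / (X r - Y r) < 1 + R := by
    intro r hr
    have hrt : r.toNNReal ≤ t := Real.toNNReal_le_iff_le_coe.2 hr.2
    have hrT : r.toNNReal < T := lt_of_le_of_lt hrt htT
    exact ⟨(hfacts _ hrT).1, (hfacts _ hrT).2, hZ _ hrT⟩
  -- the two integrands
  set ψ : ℝ → ℝ := fun r ↦ 2 / (X r * Y r) with hψ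
  set I : ℝ → ℝ := fun r ↦ (κ : ℝ) * sameSideKernel a (X r / (X r - Y r)) ^ 2 / (X r - Y r) ^ 2 with hI
  have hψc : ContinuousOn ψ (Icc 0 t) := fun r hr ↦
    (continuousAt_const.div (hXc.continuousAt.mul hYc.continuousAt)
      (mul_ne_zero ((hfactsr r hr).1.trans (hfactsr r hr).2.1).ne' (hfactsr r hr).1.ne')).continuousWithinAt
  have hIc : ContinuousOn I (Icc 0 t) := by
    intro r hr
    obtain ⟨hYr, hYX, -⟩ := hfactsr r hr
    have hUr : X r - Y r ≠ 0 := by linarith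
    have hZr : 1 < X r / (X r - Y r) := by
      rw [one_lt_div (sub_pos.2 hYX)]; linarith
    have hZc : ContinuousAt (fun r ↦ X r / (X r - Y r)) r :=
      hXc.continuousAt.div (hXc.continuousAt.sub hYc.continuousAt) hUr
    have hKc : ContinuousAt (fun r ↦ sameSideKernel a (X r / (X r - Y r))) r :=
      ContinuousAt.comp (g := sameSideKernel a) (f := fun r ↦ X r / (X r - Y r)) (x := r)
        ((continuousOn_sameSideKernel a).continuousAt (Ioi_mem_nhds hZr)) hZc
    exact (((continuousAt_const.mul (hKc.pow 2)).div ((hXc.continuousAt.sub hYc.continuousAt).pow 2)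
      (pow_ne_zero 2 hUr))).continuousWithinAt
  -- pointwise domination `c ψ ≤ I` on `[0, t]`
  have hdom : ∀ r ∈ Icc (0 : ℝ) t, c * ψ r ≤ I r := by
    intro r hr
    obtain ⟨hYr, hYX, hZr⟩ := hfactsr r hr
    have h := sameSideKernel_sq_div_sq_ge ha4 hR hYr hYX hZr
    have hXY : 0 < X r * Y r := mul_pos (hYr.trans hYX) hYr
    simp only [hψ, hI, hc]
    calc (κ : ℝ) * W ^ (1 - 4 * a) / 2 * (2 / (X r * Y r))
          = (κ : ℝ) * (((1 + R) * R) ^ (1 - 4 * a) / (X r * Y r)) := by rw [hW]; field_simp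
      _ ≤ (κ : ℝ) * (sameSideKernel a (X r / (X r - Y r)) ^ 2 / (X r - Y r) ^ 2) :=
          mul_le_mul_of_nonneg_left h hκ0.le
      _ = (κ : ℝ) * sameSideKernel a (X r / (X r - Y r)) ^ 2 / (X r - Y r) ^ 2 := by ring
  -- `∫₀ᵗ ψ = log(x-y) - log(X_t - Y_t)` and the gap is `< ε`
  have hlog := log_sleRealFlowStop_gap_eq (κ := κ) hy hyx htT'
  obtain ⟨hYt, hYXt⟩ := hfacts t htT
  have hUpos : 0 < sleRealFlowStop κ x t ω - sleRealFlowStop κ y t ω := sub_pos.2 hYXt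
  have hUε : sleRealFlowStop κ x t ω - sleRealFlowStop κ y t ω < ε := by linarith
  have hlogU : Real.log (sleRealFlowStop κ x t ω - sleRealFlowStop κ y t ω) <
      Real.log (x - y) - (C + 1) / c := by
    have := Real.log_lt_log hUpos hUε
    rwa [hε, Real.log_exp] at this
  have hψint : (C + 1) / c < ∫ r in (0 : ℝ)..t, ψ r := by
    have : ∫ r in (0 : ℝ)..t, ψ r =
        Real.log (x - y) - Real.log (sleRealFlowStop κ x t ω - sleRealFlowStop κ y t ω) := by
      simp only [hψ, hX, hY]; linarith
    rw [this]; linarith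
  -- compare the integrals
  have hmono : ∫ r in (0 : ℝ)..t, c * ψ r ≤ ∫ r in (0 : ℝ)..t, I r :=
    intervalIntegral.integral_mono_on t.coe_nonneg
      ((hψc.intervalIntegrable_of_Icc t.coe_nonneg).const_mul c)
      (hIc.intervalIntegrable_of_Icc t.coe_nonneg) hdom
  rw [intervalIntegral.integral_const_mul] at hmono
  have hC : C ≤ c * ∫ r in (0 : ℝ)..t, ψ r := by
    have h1 : C + 1 < c * ∫ r in (0 : ℝ)..t, ψ r := by
      have := (div_lt_iff₀' hcpos).1 hψint
      linarith
    linarith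
  exact hC.trans hmono

/-! ### The diagonal levels are eventually harmless before `T_y` -/

/-- **Before `T_y`, the diagonal `Y`-levels are eventually not reached on `[0, t]`**: for
`t < T_y` there is `N` such that for all `n ≥ N`, `t < τ_n` (the exit time of `Y` from
`(y/(n+2), y+n+1)`) and `t ≤ n`. (`Y` is continuous and positive on the compact `[0, t]`.)
[folklore] -/
theorem exists_forall_lt_exitTime (hy : 0 < y) {ω : ℝ≥0 → ℝ} {t : ℝ≥0}
    (ht : (t : WithTop ℝ≥0) < swallowingTime (sleDriving κ ω) y) :
    ∃ N : ℕ, ∀ n : ℕ, N ≤ n →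
      (t : WithTop ℝ≥0) < exitTime (sleRealFlowStop κ y) (y / (n + 2)) (y + n + 1) ω ∧ (t : ℝ) ≤ n := by
  have hYc : Continuous fun s ↦ sleRealFlowStop κ y s ω := continuous_sleRealFlowStop hy.ne' ω
  have hy0 : sleDriving κ ω 0 < y := by rw [sleDriving_zero]; exact hy
  have hpos : ∀ s : ℝ≥0, s ≤ t → 0 < sleRealFlowStop κ y s ω := by
    intro s hs
    have hs' : (s : WithTop ℝ≥0) < swallowingTime (sleDriving κ ω) y :=
      lt_of_le_of_lt (WithTop.coe_le_coe.2 hs) ht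
    rw [sleRealFlowStop_apply, realFlowStop_of_lt hs']
    exact realFlow_pos (continuous_sleDriving κ ω) hy0 hs'
  -- min and max of `Y` on `[0, t]`
  have hK : IsCompact (Icc (0 : ℝ≥0) t) := isCompact_Icc
  have hne : (Icc (0 : ℝ≥0) t).Nonempty := ⟨0, le_rfl, zero_le⟩
  obtain ⟨s₁, hs₁, hmin⟩ := hK.exists_isMinOn hne hYc.continuousOn
  obtain ⟨s₂, hs₂, hmax⟩ := hK.exists_isMaxOn hne hYc.continuousOn
  set m : ℝ := sleRealFlowStop κ y s₁ ω with hm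
  set M : ℝ := sleRealFlowStop κ y s₂ ω with hM
  have hmpos : 0 < m := hpos s₁ hs₁.2
  -- choose `N`
  obtain ⟨N₁, hN₁⟩ := exists_nat_gt (y / m)
  obtain ⟨N₂, hN₂⟩ := exists_nat_gt (M - y)
  obtain ⟨N₃, hN₃⟩ := exists_nat_ge (t : ℝ)
  refine ⟨max N₁ (max N₂ N₃), fun n hn ↦ ?_⟩
  have hn₁ : (N₁ : ℝ) ≤ n := by exact_mod_cast (le_max_left _ _).trans hn
  have hn₂ : (N₂ : ℝ) ≤ n := by exact_mod_cast ((le_max_left _ _).trans (le_max_right _ _)).trans hn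
  have hn₃ : (N₃ : ℝ) ≤ n := by exact_mod_cast ((le_max_right _ _).trans (le_max_right _ _)).trans hn
  have hδ₁ : y / (n + 2) < m := by
    rw [div_lt_iff₀ (by positivity)]
    have h1 : y / m < n + 2 := by linarith
    rw [div_lt_iff₀ hmpos] at h1
    linarith
  have hR₁ : M < y + n + 1 := by linarith
  refine ⟨?_, hN₃.trans hn₃⟩
  by_contra hle
  rw [not_lt, exitTime_le_coe_iff hYc] at hle
  obtain ⟨j, hj, hjout⟩ := hle
  have hjmem : j ∈ Icc (0 : ℝ≥0) t := ⟨zero_le, hj⟩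
  refine hjout ⟨lt_of_lt_of_le hδ₁ (hmin hjmem), lt_of_le_of_lt (hmax hjmem) hR₁⟩

/-! ### The two eventual inclusions -/

section Eventually

variable (hy : 0 < y) (hyx : y < x) {R : ℝ} (hz₀' : x / (x - y) < 1 + R)
include hy hyx hz₀'

omit hz₀' in
/-- Validity of the diagonal levels: `0 < δ₁ < y < R₁`, `0 < δ₀`, `1 + δ₀ < z₀` for
`δ₁ = y/(n+2)`, `R₁ = y+n+1`, `δ₀ = δ₁/(2(x-y))`. [folklore] -/
theorem sameSide_diagonal_levels (n : ℕ) :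
    0 < y / (n + 2) / (2 * (x - y)) ∧ 1 + y / (n + 2) / (2 * (x - y)) < x / (x - y) ∧
      0 < y / (n + 2) ∧ y / (n + 2) < y ∧ y < y + n + 1 := by
  have hxy : 0 < x - y := by linarith
  have hn : (0 : ℝ) ≤ n := n.cast_nonneg
  have hδ₁ : 0 < y / (n + 2) := by positivity
  have hδ₁y : y / (n + 2) < y := by
    rw [div_lt_iff₀ (by positivity)]; nlinarith
  refine ⟨by positivity, ?_, hδ₁, hδ₁y, by linarith⟩
  have hz : x / (x - y) = 1 + y / (x - y) := by field_simp; ring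
  rw [hz, add_lt_add_iff_left, div_div, div_lt_div_iff₀ (by positivity) hxy]
  have hpos : 0 < y * (x - y) := mul_pos hy hxy
  calc y * (x - y) < y * (x - y) * (2 * (n + 2)) := lt_mul_of_one_lt_right hpos (by linarith)
    _ = y * ((n + 2) * (2 * (x - y))) := by ring

/-- **If the ratio reaches `1 + R` before `T_y`, the stopped ratio eventually reads `1 + R`.**
For `0 < y < x`, `z₀ = x/(x-y) < 1 + R`: if `Z_t = X_t/(X_t - Y_t) ≥ 1 + R` at some `t < T_y`,
then for all large `n`, the ratio of the flows stopped at the diagonal same-side stopping time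
`ρ_n` (levels `δ₁ = y/(n+2)`, `R₁ = y+n+1`, `δ₀ = δ₁/(2(x-y))`, `R`), read at time `n`, equals
`1 + R`: the `Y`-levels have not fired by time `t` (`exists_forall_lt_exitTime`), the ratio has
left `(1+δ₀, 1+R)` by time `t ≤ n`, and not through `1 + δ₀` since `Z - 1 ≥ Y/(x-y) ≥ 2δ₀` while
`Y ≥ δ₁` (`div_le_sameSideRatio_sub_one`). [cite: RohdeSchramm2005, proof of Lemma 6.6] -/
theorem eventually_sameSide_stopped_ratio_eq {ω : ℝ≥0 → ℝ} {t : ℝ≥0}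
    (ht : (t : WithTop ℝ≥0) < swallowingTime (sleDriving κ ω) y)
    (hZt : 1 + R ≤ sleRealFlowStop κ x t ω / (sleRealFlowStop κ x t ω - sleRealFlowStop κ y t ω)) :
    ∃ N : ℕ, ∀ n : ℕ, N ≤ n →
      stoppedProcess (sleRealFlowStop κ x)
          (sleSameSideTime κ x y (y / (n + 2) / (2 * (x - y))) R (y / (n + 2)) (y + n + 1)) n ω /
        (stoppedProcess (sleRealFlowStop κ x)
            (sleSameSideTime κ x y (y / (n + 2) / (2 * (x - y))) R (y / (n + 2)) (y + n + 1)) n ω -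
          stoppedProcess (sleRealFlowStop κ y)
            (sleSameSideTime κ x y (y / (n + 2) / (2 * (x - y))) R (y / (n + 2)) (y + n + 1)) n ω) =
        1 + R := by
  have hx : 0 < x := hy.trans hyx
  have hxy : 0 < x - y := by linarith
  obtain ⟨N, hN⟩ := exists_forall_lt_exitTime (κ := κ) hy ht
  refine ⟨N, fun n hn ↦ ?_⟩
  obtain ⟨htτ, htn⟩ := hN n hn
  obtain ⟨hδ₀, hz₀, hδ₁, hδ₁y, hyR₁⟩ := sameSide_diagonal_levels hy hyx n
  set δ₁ : ℝ := y / (n + 2) with hδ₁def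
  set R₁ : ℝ := y + n + 1 with hR₁def
  set δ₀ : ℝ := δ₁ / (2 * (x - y)) with hδ₀def
  set τ := exitTime (sleRealFlowStop κ y) δ₁ R₁ ω with hτdef
  have hXc : Continuous fun s ↦ sleRealFlowStop κ x s ω := continuous_sleRealFlowStop hx.ne' ω
  have hYc : Continuous fun s ↦ sleRealFlowStop κ y s ω := continuous_sleRealFlowStop hy.ne' ω
  have hZhc : Continuous fun s ↦ sleSameSideRatio κ x y δ₁ R₁ s ω :=
    continuous_sleSameSideRatio hy hyx hδ₁ hδ₁y hyR₁ ω
  have hZh0 : sleSameSideRatio κ x y δ₁ R₁ 0 ω ∈ Ioo (1 + δ₀) (1 + R) := by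
    simp only [sleSameSideRatio, stoppedProcess, untopA_min_zero, sleRealFlowStop_zero_apply hx.ne',
      sleRealFlowStop_zero_apply hy.ne']
    exact ⟨hz₀, hz₀'⟩
  -- facts at times `≤ τ`
  have hfacts : ∀ {s : ℝ≥0}, (s : WithTop ℝ≥0) ≤ τ →
      (s : WithTop ℝ≥0) < swallowingTime (sleDriving κ ω) y ∧ sleRealFlowStop κ y s ω ∈ Icc δ₁ R₁ ∧
        sleRealFlowStop κ y s ω < sleRealFlowStop κ x s ω :=
    fun hs ↦ sleRealFlowStop_facts_of_le_exitTime hy hyx hδ₁ hδ₁y hyR₁ hs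
  have hZheq : ∀ {s : ℝ≥0}, (s : WithTop ℝ≥0) ≤ τ →
      sleSameSideRatio κ x y δ₁ R₁ s ω =
        sleRealFlowStop κ x s ω / (sleRealFlowStop κ x s ω - sleRealFlowStop κ y s ω) := by
    intro s hs
    unfold sleSameSideRatio
    rw [stoppedProcess_eq_of_le (τ := exitTime (sleRealFlowStop κ y) δ₁ R₁) hs,
      stoppedProcess_eq_of_le (τ := exitTime (sleRealFlowStop κ y) δ₁ R₁) hs]
  -- while `Y ≥ δ₁`, the ratio is above `1 + 2δ₀`
  have hZlow : ∀ {s : ℝ≥0}, (s : WithTop ℝ≥0) ≤ τ →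
      1 + 2 * δ₀ ≤ sleRealFlowStop κ x s ω / (sleRealFlowStop κ x s ω - sleRealFlowStop κ y s ω) := by
    intro s hs
    obtain ⟨hsT, hYs, -⟩ := hfacts hs
    have h := div_le_sameSideRatio_sub_one (κ := κ) hy hyx hsT
    have h2 : 2 * δ₀ ≤ sleRealFlowStop κ y s ω / (x - y) := by
      rw [hδ₀def, le_div_iff₀ hxy]
      have : δ₁ / (2 * (x - y)) * (x - y) = δ₁ / 2 := by field_simp
      nlinarith [hYs.1]
    linarith
  -- the ratio has left `(1+δ₀, 1+R)` by time `t`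
  set σ := exitTime (sleSameSideRatio κ x y δ₁ R₁) (1 + δ₀) (1 + R) ω with hσdef
  have hσt : σ ≤ (t : WithTop ℝ≥0) := by
    rw [hσdef, exitTime_le_coe_iff hZhc]
    refine ⟨t, le_rfl, fun hmem ↦ ?_⟩
    rw [hZheq htτ.le] at hmem
    exact (not_lt.2 hZt) hmem.2
  obtain ⟨r, hr⟩ := WithTop.ne_top_iff_exists.1 (ne_top_of_le_ne_top WithTop.coe_ne_top hσt)
  have hrt : r ≤ t := by rw [← hr] at hσt; exact WithTop.coe_le_coe.1 hσt
  have hrτ : ((r : ℝ≥0) : WithTop ℝ≥0) ≤ τ := by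
    rw [hr]; exact hσt.trans htτ.le
  -- `ρ_n = σ = r ≤ n`
  have hρeq : sleSameSideTime κ x y δ₀ R δ₁ R₁ ω = r := by
    change min τ σ = r
    rw [min_eq_right (hσt.trans htτ.le), hr]
  have hrn : ((r : ℝ≥0) : WithTop ℝ≥0) ≤ (n : ℝ≥0) := by
    refine WithTop.coe_le_coe.2 ?_
    rw [← NNReal.coe_le_coe]
    exact (NNReal.coe_le_coe.2 hrt).trans (by simpa using htn)
  have hρn : sleSameSideTime κ x y δ₀ R δ₁ R₁ ω ≤ ((n : ℝ≥0) : WithTop ℝ≥0) := by rw [hρeq]; exact hrn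
  have hstopX : stoppedProcess (sleRealFlowStop κ x) (sleSameSideTime κ x y δ₀ R δ₁ R₁) n ω =
      sleRealFlowStop κ x r ω := by
    rw [stoppedProcess_eq_of_ge hρn, hρeq]; rfl
  have hstopY : stoppedProcess (sleRealFlowStop κ y) (sleSameSideTime κ x y δ₀ R δ₁ R₁) n ω =
      sleRealFlowStop κ y r ω := by
    rw [stoppedProcess_eq_of_ge hρn, hρeq]; rfl
  rw [hstopX, hstopY]
  -- exit value of the ratio at `r`
  have hexit := apply_eq_or_eq_of_exitTime_eq_coe hZhc hZh0 hr.symm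
  rw [hZheq hrτ] at hexit
  rcases hexit with h1 | h1
  · have := hZlow hrτ
    rw [h1] at this
    linarith
  · exact h1

/-- **On the bad event the stopped energies eventually exceed any constant.** For `4 < κ < 8`,
`0 < y < x`, `z₀ < 1 + R`: if `T_y = T_x = T < ∞` and `Z < 1 + R` throughout `[0, T)`, then for
every `C` and all large `n`, `C ≤ ∫₀^{n∧ρ_n} κ K(Z_s)²/(X_s-Y_s)² ds` (`ρ_n` the diagonal same-side
stopping time): by `exists_le_integral_sameSide_energy` some `t < T` already carries energy `C`,
and for large `n` the stopping has not occurred by time `t ≤ n` (`exists_forall_lt_exitTime`; the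
ratio stays in `(1+δ₀, 1+R)` on `[0, t]`). [cite: RohdeSchramm2005, proof of Lemma 6.6] -/
theorem eventually_le_sameSide_energy (hκ4 : 4 < κ) (hκ8 : κ < 8) {ω : ℝ≥0 → ℝ} {T : ℝ≥0}
    (hTy : swallowingTime (sleDriving κ ω) y = T) (hTx : swallowingTime (sleDriving κ ω) x = T)
    (hZ : ∀ t : ℝ≥0, t < T →
      sleRealFlowStop κ x t ω / (sleRealFlowStop κ x t ω - sleRealFlowStop κ y t ω) < 1 + R)
    (C : ℝ) :
    ∃ N : ℕ, ∀ n : ℕ, N ≤ n →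
      C ≤ timeIntegral (trunc (sleSameSideTime κ x y (y / (n + 2) / (2 * (x - y))) R (y / (n + 2))
          (y + n + 1)) fun s ω ↦
        (κ : ℝ) * sameSideKernel (2 / (κ : ℝ))
            (sleRealFlowStop κ x s ω / (sleRealFlowStop κ x s ω - sleRealFlowStop κ y s ω)) ^ 2 /
          (sleRealFlowStop κ x s ω - sleRealFlowStop κ y s ω) ^ 2) n ω := by
  have hx : 0 < x := hy.trans hyx
  have hxy : 0 < x - y := by linarith
  have hz₀1 : 1 < x / (x - y) := by rw [one_lt_div hxy]; linarith
  have hR : 0 < R := by linarith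
  obtain ⟨t, htT, hCt⟩ := exists_le_integral_sameSide_energy hκ4 hκ8 hy hyx hR hTy hTx hZ C
  have ht : (t : WithTop ℝ≥0) < swallowingTime (sleDriving κ ω) y := by
    rw [hTy]; exact_mod_cast htT
  obtain ⟨N, hN⟩ := exists_forall_lt_exitTime (κ := κ) hy ht
  refine ⟨N, fun n hn ↦ ?_⟩
  obtain ⟨htτ, htn⟩ := hN n hn
  obtain ⟨hδ₀, hz₀, hδ₁, hδ₁y, hyR₁⟩ := sameSide_diagonal_levels hy hyx n
  set δ₁ : ℝ := y / (n + 2) with hδ₁def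
  set R₁ : ℝ := y + n + 1 with hR₁def
  set δ₀ : ℝ := δ₁ / (2 * (x - y)) with hδ₀def
  set τ := exitTime (sleRealFlowStop κ y) δ₁ R₁ ω with hτdef
  set ρ := sleSameSideTime κ x y δ₀ R δ₁ R₁ with hρdef
  set a : ℝ := 2 / (κ : ℝ) with ha
  have hXc : Continuous fun s ↦ sleRealFlowStop κ x s ω := continuous_sleRealFlowStop hx.ne' ω
  have hYc : Continuous fun s ↦ sleRealFlowStop κ y s ω := continuous_sleRealFlowStop hy.ne' ω
  have hZhc : Continuous fun s ↦ sleSameSideRatio κ x y δ₁ R₁ s ω :=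
    continuous_sleSameSideRatio hy hyx hδ₁ hδ₁y hyR₁ ω
  have hfacts : ∀ {s : ℝ≥0}, (s : WithTop ℝ≥0) ≤ τ →
      (s : WithTop ℝ≥0) < swallowingTime (sleDriving κ ω) y ∧ sleRealFlowStop κ y s ω ∈ Icc δ₁ R₁ ∧
        sleRealFlowStop κ y s ω < sleRealFlowStop κ x s ω :=
    fun hs ↦ sleRealFlowStop_facts_of_le_exitTime hy hyx hδ₁ hδ₁y hyR₁ hs
  have hZheq : ∀ {s : ℝ≥0}, (s : WithTop ℝ≥0) ≤ τ →
      sleSameSideRatio κ x y δ₁ R₁ s ω =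
        sleRealFlowStop κ x s ω / (sleRealFlowStop κ x s ω - sleRealFlowStop κ y s ω) := by
    intro s hs
    unfold sleSameSideRatio
    rw [stoppedProcess_eq_of_le (τ := exitTime (sleRealFlowStop κ y) δ₁ R₁) hs,
      stoppedProcess_eq_of_le (τ := exitTime (sleRealFlowStop κ y) δ₁ R₁) hs]
  have hZlow : ∀ {s : ℝ≥0}, (s : WithTop ℝ≥0) ≤ τ →
      1 + 2 * δ₀ ≤ sleRealFlowStop κ x s ω / (sleRealFlowStop κ x s ω - sleRealFlowStop κ y s ω) := by
    intro s hs
    obtain ⟨hsT, hYs, -⟩ := hfacts hs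
    have h := div_le_sameSideRatio_sub_one (κ := κ) hy hyx hsT
    have h2 : 2 * δ₀ ≤ sleRealFlowStop κ y s ω / (x - y) := by
      rw [hδ₀def, le_div_iff₀ hxy]
      have : δ₁ / (2 * (x - y)) * (x - y) = δ₁ / 2 := by field_simp
      nlinarith [hYs.1]
    linarith
  -- the ratio stays in the box on `[0, t]`, so `t < ρ`
  have htσ : (t : WithTop ℝ≥0) < exitTime (sleSameSideRatio κ x y δ₁ R₁) (1 + δ₀) (1 + R) ω := by
    by_contra hle
    rw [not_lt, exitTime_le_coe_iff hZhc] at hle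
    obtain ⟨j, hj, hjout⟩ := hle
    have hjτ : ((j : ℝ≥0) : WithTop ℝ≥0) ≤ τ := (WithTop.coe_le_coe.2 hj).trans htτ.le
    have hjT : j < T := lt_of_le_of_lt hj htT
    refine hjout ?_
    rw [hZheq hjτ]
    exact ⟨by linarith [hZlow hjτ], hZ j hjT⟩
  have htρ : (t : WithTop ℝ≥0) < ρ ω := lt_min htτ htσ
  -- the clock `m = n ∧ ρ` satisfies `t ≤ m ≤ ρ ≤ τ`
  set m : ℝ≥0 := (min ((n : ℝ≥0) : WithTop ℝ≥0) (ρ ω)).untopA with hmdef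
  have hmρ : ((m : ℝ≥0) : WithTop ℝ≥0) ≤ ρ ω := coe_untopA_min_le _ _
  have hmτ : ((m : ℝ≥0) : WithTop ℝ≥0) ≤ τ := hmρ.trans (min_le_left _ _)
  have htm : t ≤ m := by
    have h1 : (t : WithTop ℝ≥0) ≤ min ((n : ℝ≥0) : WithTop ℝ≥0) (ρ ω) :=
      le_min (by exact_mod_cast (show (t : ℝ) ≤ n from htn)) htρ.le
    rw [← coe_untopA_min] at h1
    exact WithTop.coe_le_coe.1 h1
  rw [timeIntegral_trunc]
  change C ≤ ∫ s in (0 : ℝ)..m, (κ : ℝ) * sameSideKernel a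
      (sleRealFlowStop κ x s.toNNReal ω / (sleRealFlowStop κ x s.toNNReal ω - sleRealFlowStop κ y s.toNNReal ω)) ^ 2 /
    (sleRealFlowStop κ x s.toNNReal ω - sleRealFlowStop κ y s.toNNReal ω) ^ 2
  -- real-variable integrand, continuous and non-negative on `[0, m]`
  set X : ℝ → ℝ := fun r ↦ sleRealFlowStop κ x r.toNNReal ω with hX
  set Y : ℝ → ℝ := fun r ↦ sleRealFlowStop κ y r.toNNReal ω with hY
  have hXrc : Continuous X := hXc.comp continuous_real_toNNReal
  have hYrc : Continuous Y := hYc.comp continuous_real_toNNReal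
  have hfactsr : ∀ r ∈ Icc (0 : ℝ) m, δ₁ ≤ Y r ∧ Y r < X r := by
    intro r hr
    have hrm : ((r.toNNReal : ℝ≥0) : WithTop ℝ≥0) ≤ τ :=
      (WithTop.coe_le_coe.2 (Real.toNNReal_le_iff_le_coe.2 hr.2)).trans hmτ
    obtain ⟨-, hYr, hYX⟩ := hfacts hrm
    exact ⟨hYr.1, hYX⟩
  set I : ℝ → ℝ := fun r ↦ (κ : ℝ) * sameSideKernel a (X r / (X r - Y r)) ^ 2 / (X r - Y r) ^ 2 with hI
  have hIc : ContinuousOn I (Icc 0 m) := by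
    intro r hr
    obtain ⟨hYr, hYX⟩ := hfactsr r hr
    have hYpos : 0 < Y r := hδ₁.trans_le hYr
    have hUr : X r - Y r ≠ 0 := by linarith
    have hZr : 1 < X r / (X r - Y r) := by
      rw [one_lt_div (sub_pos.2 hYX)]; linarith
    have hZc : ContinuousAt (fun r ↦ X r / (X r - Y r)) r :=
      hXrc.continuousAt.div (hXrc.continuousAt.sub hYrc.continuousAt) hUr
    have hKc : ContinuousAt (fun r ↦ sameSideKernel a (X r / (X r - Y r))) r :=
      ContinuousAt.comp (g := sameSideKernel a) (f := fun r ↦ X r / (X r - Y r)) (x := r)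
        ((continuousOn_sameSideKernel a).continuousAt (Ioi_mem_nhds hZr)) hZc
    exact (((continuousAt_const.mul (hKc.pow 2)).div ((hXrc.continuousAt.sub hYrc.continuousAt).pow 2)
      (pow_ne_zero 2 hUr))).continuousWithinAt
  have hInn : ∀ r ∈ Icc (0 : ℝ) m, 0 ≤ I r := by
    intro r hr
    obtain ⟨hYr, hYX⟩ := hfactsr r hr
    have hYpos : 0 < Y r := hδ₁.trans_le hYr
    have hZr : 1 < X r / (X r - Y r) := by
      rw [one_lt_div (sub_pos.2 hYX)]; linarith
    have hK := sameSideKernel_pos a hZr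
    simp only [hI]
    positivity
  have hmono := intervalIntegral.integral_mono_interval (μ := volume) (f := I) (c := 0) (d := m)
    (a := 0) (b := t) le_rfl t.coe_nonneg (NNReal.coe_le_coe.2 htm)
    ((ae_restrict_iff' measurableSet_Ioc).2 (ae_of_all _ fun r hr ↦ hInn r ⟨hr.1.le, hr.2⟩))
    (hIc.intervalIntegrable_of_Icc m.coe_nonneg)
  exact hCt.trans hmono

end Eventually

end Literature.Probability.RandomPlanarGeometry
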